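import Literature.Probability.RandomPlanarGeometry.SAWAdsorptionIrreducibleBridges
import Mathlib.Analysis.Subadditive
import HarnessLib

/-!
# The adsorbed growth rate `β(a)` of wall-returning `x`-bridges: supermultiplicativity and Fekete

Topic `Literature/Probability/RandomPlanarGeometry` (continues `SAWAdsorptionIrreducibleBridges.lean`: the pieces
`AdsIrr.IsWXB`, their weighted counts `B_n(a) = AdsIrr.Bw n a`, `IsWXB.append`, `visits_append`, `Bw_pos`, `Bw_le_adsZ`).

Hammersley–Torrie–Whittington 1982 prove that the adsorption free energy `κ(a) = lim n⁻¹ log Z⁺_n(a)` exists (reported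
in Beaton–Guttmann–Jensen 2012, §1 p. 2). The first step of the bridge route to that theorem, for the wall problem: the
weighted counts of wall-returning `x`-bridges are SUPERMULTIPLICATIVE, `B_m(a) B_n(a) ≤ B_{m+n}(a)` (`AdsIrr.Bw_mul_le`:
concatenation, Madras–Slade (1.2.18) for bridges), and bounded by `(4 max(1,a))ⁿ`; hence by Fekete's lemma
(Madras–Slade Lemma 1.2.2) **`B_n(a)^{1/n}` converges to a limit `β(a) > 0` with `B_n(a) ≤ β(a)ⁿ` for all `n`**
(`AdsIrr.exists_tendsto_Bw_rpow`) — the adsorbed analogue of `μ_bridge` (Madras–Slade (1.2.19)). Consequently every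
certificate `AdsorbedAbove a Λ` obtained from the pieces (e.g. `Zd.adsorbedAbove_209`) reads `Λ ≤ β(a) ≤ e^{κ(a)}`.
Pure standard axioms.
-/

open Finset Filter Topology
open scoped BigOperators

namespace Literature.Probability.RandomPlanarGeometry.SAW.AdsIrr

/-! ### Supermultiplicativity -/

/-- **`B_m(a) · B_n(a) ≤ B_{m+n}(a)`** (`a ≥ 0`): concatenation of pieces is injective and multiplies weights.
[cite: MadrasSlade1993, §1.2, eq. (1.2.18) (p. 11)] [cite: BeatonGuttmannJensen2012Adsorption, §1 (p. 2)] -/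
theorem Bw_mul_le (m n : ℕ) {a : ℝ} (ha : 0 ≤ a) : Bw m a * Bw n a ≤ Bw (m + n) a := by
  classical
  have hmem : ∀ x ∈ wxbWords m ×ˢ wxbWords n,
      x.1.length = m ∧ IsWXB x.1 ∧ x.2.length = n ∧ IsWXB x.2 := by
    rintro ⟨p, b⟩ hx
    simp only [Finset.mem_product, mem_wxbWords] at hx
    exact ⟨hx.1.1, hx.1.2, hx.2.1, hx.2.2⟩
  have step1 : Bw m a * Bw n a = ∑ x ∈ wxbWords m ×ˢ wxbWords n, a ^ visits (x.1 ++ x.2) := by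
    rw [Bw, Bw, Finset.sum_mul_sum, Finset.sum_product]
    refine Finset.sum_congr rfl fun p hp => Finset.sum_congr rfl fun b _ => ?_
    rw [visits_append (mem_wxbWords.1 hp).2.2.2.1, pow_add]
  have hinj : Set.InjOn (fun x : List Step × List Step => x.1 ++ x.2) ↑(wxbWords m ×ˢ wxbWords n) := by
    rintro ⟨p, b⟩ hx ⟨p', b'⟩ hx' h
    obtain ⟨hpl, -, -, -⟩ := hmem _ hx
    obtain ⟨hpl', -, -, -⟩ := hmem _ hx'
    obtain ⟨rfl, rfl⟩ := List.append_inj h (hpl.trans hpl'.symm)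
    rfl
  rw [step1, ← Finset.sum_image (f := fun w => a ^ visits w) hinj, Bw]
  refine Finset.sum_le_sum_of_subset_of_nonneg (fun w hw => ?_) fun _ _ _ => pow_nonneg ha _
  obtain ⟨x, hx, rfl⟩ := Finset.mem_image.1 hw
  obtain ⟨hpl, hpW, hbl, hbW⟩ := hmem x hx
  exact mem_wxbWords.2 ⟨by rw [List.length_append, hpl, hbl], hpW.append hbW⟩

/-! ### A priori bounds -/

/-- `B_0(a) = 1` (the empty piece). [cite: MadrasSlade1993, §1.2 (p. 11)] -/
theorem Bw_zero (a : ℝ) : Bw 0 a = 1 := by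
  have h : wxbWords 0 = {[]} := by
    ext w
    simp only [mem_wxbWords, List.length_eq_zero_iff, Finset.mem_singleton]
    constructor
    · rintro ⟨rfl, -⟩; rfl
    · rintro rfl; exact ⟨rfl, isWXB_nil⟩
  rw [Bw, h, Finset.sum_singleton]
  simp [visits]

/-- A word of length `n` has at most `n` wall visits. [cite: BeatonGuttmannJensen2012Adsorption, §1 (p. 2)] -/
theorem visits_le_length (w : List Step) : visits w ≤ w.length := by
  unfold visits
  calc ∑ j ∈ range w.length, (if traj w (j + 1) 0 = 0 then 1 else 0)
      ≤ ∑ _j ∈ range w.length, 1 := Finset.sum_le_sum fun j _ => by split_ifs <;> omega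
    _ = w.length := by simp

/-- **`B_n(a) ≤ (4 · max(1,a))ⁿ`** (`a ≥ 0`): at most `4ⁿ` words, each of weight at most `max(1,a)ⁿ`.
[cite: MadrasSlade1993, §1.2 (p. 11)] -/
theorem Bw_le_pow (n : ℕ) {a : ℝ} (ha : 0 ≤ a) : Bw n a ≤ (4 * max 1 a) ^ n := by
  classical
  have hM : 1 ≤ max 1 a := le_max_left _ _
  calc Bw n a ≤ ∑ _w ∈ wxbWords n, (max 1 a) ^ n := by
        refine Finset.sum_le_sum fun w hw => ?_
        obtain ⟨hl, -⟩ := mem_wxbWords.1 hw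
        calc a ^ visits w ≤ (max 1 a) ^ visits w := pow_le_pow_left₀ ha (le_max_right _ _) _
          _ ≤ (max 1 a) ^ n := pow_le_pow_right₀ hM (hl ▸ visits_le_length w)
    _ = #(wxbWords n) * (max 1 a) ^ n := by rw [Finset.sum_const, nsmul_eq_mul]
    _ ≤ 4 ^ n * (max 1 a) ^ n := by
        refine mul_le_mul_of_nonneg_right ?_ (pow_nonneg (le_trans zero_le_one hM) _)
        have : #(wxbWords n) ≤ #(words n) := Finset.card_le_card (Finset.filter_subset _ _)
        rw [card_words] at this
        exact_mod_cast this
    _ = (4 * max 1 a) ^ n := by rw [mul_pow]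

/-! ### Fekete: the growth rate exists -/

/-- **The adsorbed growth rate of wall-returning `x`-bridges exists**: for `a > 0` there is `β > 0` with
`B_n(a)^{1/n} → β` and `B_n(a) ≤ βⁿ` for every `n` (Fekete's lemma on the superadditive `log B_n(a)`).
[cite: MadrasSlade1993, Lemma 1.2.2 and eq. (1.2.18)–(1.2.19) (pp. 9–11)] [cite: BeatonGuttmannJensen2012Adsorption, §1 (p. 2)] -/
theorem exists_tendsto_Bw_rpow {a : ℝ} (ha : 0 < a) :
    ∃ β : ℝ, 0 < β ∧ Tendsto (fun n : ℕ => (Bw n a) ^ (1 / (n : ℝ))) atTop (𝓝 β) ∧ ∀ n : ℕ, Bw n a ≤ β ^ n := by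
  have hpos : ∀ n, 0 < Bw n a := fun n => Bw_pos n ha
  set u : ℕ → ℝ := fun n => -Real.log (Bw n a) with hu_def
  have hu : Subadditive u := by
    intro m n
    simp only [hu_def]
    have h := Bw_mul_le m n ha.le
    have hlog := Real.log_le_log (mul_pos (hpos m) (hpos n)) h
    rw [Real.log_mul (hpos m).ne' (hpos n).ne'] at hlog
    linarith
  have hM : 0 < 4 * max 1 a := by positivity
  have hbdd : BddBelow (Set.range fun n : ℕ => u n / n) := by
    refine ⟨-Real.log (4 * max 1 a), ?_⟩
    rintro _ ⟨n, rfl⟩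
    rcases Nat.eq_zero_or_pos n with rfl | hn
    · simp only [Nat.cast_zero, div_zero]
      have : 0 ≤ Real.log (4 * max 1 a) := Real.log_nonneg (by nlinarith [le_max_left (1 : ℝ) a])
      linarith
    · have hn' : (0 : ℝ) < n := by exact_mod_cast hn
      rw [le_div_iff₀ hn', hu_def]
      have h1 := Real.log_le_log (hpos n) (Bw_le_pow n ha.le)
      rw [Real.log_pow] at h1
      simp only
      linarith
  have hlim := hu.tendsto_lim hbdd
  have key : ∀ n : ℕ, (Bw n a) ^ (1 / (n : ℝ)) = Real.exp (-(u n / n)) := fun n => by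
    rw [Real.rpow_def_of_pos (hpos n), hu_def, neg_div, neg_neg, mul_one_div]
  refine ⟨Real.exp (-hu.lim), Real.exp_pos _, ?_, fun n => ?_⟩
  · have hexp : Tendsto (fun n : ℕ => Real.exp (-(u n / n))) atTop (𝓝 (Real.exp (-hu.lim))) :=
      (Real.continuous_exp.tendsto _).comp hlim.neg
    exact hexp.congr fun n => (key n).symm
  · rcases Nat.eq_zero_or_pos n with rfl | hn
    · rw [Bw_zero, pow_zero]
    · have h1 := hu.lim_le_div hbdd (Nat.pos_iff_ne_zero.1 hn)
      have hn' : (0 : ℝ) < n := by exact_mod_cast hn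
      rw [← Real.exp_log (hpos n), ← Real.exp_nat_mul]
      refine Real.exp_le_exp.2 ?_
      rw [le_div_iff₀ hn'] at h1
      have hu_n : u n = -Real.log (Bw n a) := rfl
      rw [hu_n] at h1
      linarith

end Literature.Probability.RandomPlanarGeometry.SAW.AdsIrr
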